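import Summits.CriticalPhenomena.PercolationContinuityZ3.Theorems.PercNearOneGluingNoHeavyLowerTailSunflowerCoreCounts
import HarnessLib

/-!
# `NoHeavyLowerTail` (crux stmt-CriticalPhenomena-4575), abstract sunflower cubic: STAR-TYPE COMPOSITIONS, I — label dictionary, `NV`/`NAA` as
# cardinalities, `Lemma A ⇒ ★` for one sunflower, the composition `StarData.toSunflower`, and the group-wise mixing calculus `mix`

Support file (seat `prim-ineq-prove-1` gen 29; `--supports stmt-CriticalPhenomena-4575`).  Nothing is asserted about the crux; no `sorry`.
Memo: run/shared/lean/prim/prim-ineq-prove-1/FINDING-PAYER-prove1-g29.md §2, §5.3.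

SETTING.  The ground type `α` is split into three groups by `grp : α → Fin 3`; `U i` is an up-set of `2^α` SUPPORTED on group `i`
(`S ∈ U i ↔ S ∩ group i ∈ U i`).  The star-type composition is the sunflower `V i := ⋂_{j ≠ i} U j` (all pairwise intersections `= U 0 ∩ U 1 ∩ U 2`):
the `K_{1,3}` stars `{j ~ k}_i` of bond percolation with ARBITRARY edge multiplicities and arbitrary monotone gadgets per edge group, in particular the
doubled star of `…SunflowerDoubledStar` / `…SunflowerPartitionLemmaBRefutation` (the refutation of Lemma B and the first sunflower without a good coordinate
for the `(MZ)` mechanisms of prim-l12-p2 g8).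

THEOREM (`StarData.NV_eq_NAA`, companion file II, this work): for every star-type composition, `NV = NAA` — the ordered 3-partitions `(P¹,P²,P³)` with `Pⁱ ∈ V i`
are equinumerous with those with `P¹, P² ∈ A`, via the block switching `Ψ`: on group `0` send the pieces of `(P¹,P²,P³)` to `(P³,P¹,P²)`'s slots
as `(P²,P³,P¹)`, on group `1` swap the pieces of `P²` and `P³`, on group `2` do nothing (memo §5.3).  Hence (`…CoreCounts`: `3·SA − Ntri = 6(NAA − NV)`)
Lemma A is an identity, and with `SB ≥ 0` (antipodal Gladkov) **`0 ≤ ZH`**: the partition lemma holds on this infinite family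
(`StarData.ZH_nonneg`), hence so do its law-level consequences there (`H_{q+t}`-, `γ`-type rows via prim-l12-p2's transfer theorems).
-/

namespace Summit.CriticalPhenomena.PercolationContinuityZ3.Theorems.SunflowerPartition

open Finset

variable {α : Type*} [Fintype α] [DecidableEq α]

/-! ## Label ↔ membership dictionary for a general sunflower -/

namespace Sunflower

variable (F : Sunflower α)

omit [Fintype α] in
/-- `lab S = ⊤ ↔ S ∈ A`. [this work] -/
theorem lab_eq_four_iff (S : Finset α) : F.lab S = 4 ↔ S ∈ F.A := by
  constructor
  · intro h
    unfold lab at h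
    split_ifs at h with c1 c2 c3 c4
    · exact c1
    all_goals exact absurd h (by decide)
  · intro h
    unfold lab
    rw [if_pos h]

omit [Fintype α] in
/-- `lab S ∈ {1, ⊤} ↔ S ∈ V 0`. [this work] -/
theorem lab_V0_iff (S : Finset α) : (F.lab S = 1 ∨ F.lab S = 4) ↔ S ∈ F.V 0 := by
  constructor
  · rintro (h | h)
    · unfold lab at h
      split_ifs at h with c1 c2 c3 c4
      · exact (mem_inter.1 c1).1
      · exact c2
      all_goals exact absurd h (by decide)
    · exact (mem_inter.1 ((F.lab_eq_four_iff S).1 h)).1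
  · intro h0
    by_cases hA : S ∈ F.A
    · exact Or.inr ((F.lab_eq_four_iff S).2 hA)
    · left
      unfold lab
      rw [if_neg hA, if_pos h0]

omit [Fintype α] in
/-- `lab S ∈ {2, ⊤} ↔ S ∈ V 1`. [this work] -/
theorem lab_V1_iff (S : Finset α) : (F.lab S = 2 ∨ F.lab S = 4) ↔ S ∈ F.V 1 := by
  constructor
  · rintro (h | h)
    · unfold lab at h
      split_ifs at h with c1 c2 c3 c4
      · exact (mem_inter.1 c1).2
      · exact absurd h (by decide)
      · exact c3
      all_goals exact absurd h (by decide)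
    · exact (mem_inter.1 ((F.lab_eq_four_iff S).1 h)).2
  · intro h1
    by_cases hA : S ∈ F.A
    · exact Or.inr ((F.lab_eq_four_iff S).2 hA)
    · left
      have h0 : S ∉ F.V 0 := fun h0 => hA (F.mem_A_of_mem_mem (i := 0) (j := 1) (by decide) h0 h1)
      unfold lab
      rw [if_neg hA, if_neg h0, if_pos h1]

omit [Fintype α] in
/-- `lab S ∈ {3, ⊤} ↔ S ∈ V 2`. [this work] -/
theorem lab_V2_iff (S : Finset α) : (F.lab S = 3 ∨ F.lab S = 4) ↔ S ∈ F.V 2 := by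
  constructor
  · rintro (h | h)
    · unfold lab at h
      split_ifs at h with c1 c2 c3 c4
      · have hA : S ∈ F.V 0 ∩ F.V 2 := by rw [F.inter_eq 0 2 (by decide)]; exact c1
        exact (mem_inter.1 hA).2
      · exact absurd h (by decide)
      · exact absurd h (by decide)
      · exact c4
      · exact absurd h (by decide)
    · have hA : S ∈ F.V 0 ∩ F.V 2 := by rw [F.inter_eq 0 2 (by decide)]; exact (F.lab_eq_four_iff S).1 h
      exact (mem_inter.1 hA).2
  · intro h2
    by_cases hA : S ∈ F.A
    · exact Or.inr ((F.lab_eq_four_iff S).2 hA)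
    · left
      have h0 : S ∉ F.V 0 := fun h0 => hA (F.mem_A_of_mem_mem (i := 0) (j := 2) (by decide) h0 h2)
      have h1 : S ∉ F.V 1 := fun h1 => hA (F.mem_A_of_mem_mem (i := 1) (j := 2) (by decide) h1 h2)
      unfold lab
      rw [if_neg hA, if_neg h0, if_neg h1, if_pos h2]

/-- `NV` as a cardinality (label form). [this work] -/
theorem NV_eq_card : F.NV = (((parts α).filter fun q =>
    (F.lab q.1 = 1 ∨ F.lab q.1 = 4) ∧ (F.lab q.2 = 2 ∨ F.lab q.2 = 4) ∧
      (F.lab (q.1 ∪ q.2)ᶜ = 3 ∨ F.lab (q.1 ∪ q.2)ᶜ = 4)).card : ℤ) := by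
  unfold NV vind
  rw [Finset.natCast_card_filter]

/-- `NAA` as a cardinality (label form). [this work] -/
theorem NAA_eq_card : F.NAA = (((parts α).filter fun q => F.lab q.1 = 4 ∧ F.lab q.2 = 4).card : ℤ) := by
  unfold NAA pairA
  rw [Finset.natCast_card_filter]

/-- **Lemma A ⇒ ★** for one sunflower: `NV ≤ NAA → 0 ≤ ZH` (`ZH = 6(NAA − NV) + 3·SB`, `SB ≥ 0`). [this work] -/
theorem ZH_nonneg_of_NV_le_NAA (h : F.NV ≤ F.NAA) : 0 ≤ F.ZH := by
  have h1 := F.ZH_eq_SA_SB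
  have h2 := F.three_SA_sub_Ntri
  have h3 := F.SB_nonneg
  linarith

end Sunflower

/-! ## Star-type compositions -/

/-- Data of a star-type composition: a splitting of `α` into three groups and, for each group, an up-set of `2^α` supported on that group. [this work] -/
structure StarData (α : Type*) [Fintype α] [DecidableEq α] where
  /-- the group of a coordinate -/
  grp : α → Fin 3
  /-- the three monotone structures (`U i` = "group `i` fires") -/
  U : Fin 3 → Finset (Finset α)
  /-- each `U i` is an up-set -/
  upper : ∀ i, IsUpperSet (U i : Set (Finset α))
  /-- `U i` only looks at group `i` -/
  supp : ∀ i (S : Finset α), S ∈ U i ↔ S.filter (fun x => grp x = i) ∈ U i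

namespace StarData

variable (D : StarData α)

/-- The star-type composition: `V i = ⋂_{j ≠ i} U j` ("the other two groups fire"). [this work] -/
def toSunflower : Sunflower α where
  V i := univ.filter fun S => ∀ j, j ≠ i → S ∈ D.U j
  upper i := by
    intro S T hST hS
    simp only [coe_filter, mem_univ, true_and, Set.mem_setOf_eq] at hS ⊢
    exact fun j hj => D.upper j hST (hS j hj)
  inter_eq i j hij := by
    ext S
    simp only [mem_inter, mem_filter, mem_univ, true_and]
    constructor
    · rintro ⟨hi, hj⟩
      have hall : ∀ k, S ∈ D.U k := by
        intro k
        by_cases hk : k = i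
        · rw [hk]; exact hj i hij
        · exact hi k hk
      exact ⟨fun k _ => hall k, fun k _ => hall k⟩
    · rintro ⟨h0, h1⟩
      have hall : ∀ k, S ∈ D.U k := by
        intro k
        by_cases hk : k = 0
        · subst hk; exact h1 0 (by decide)
        · exact h0 k hk
      exact ⟨fun k _ => hall k, fun k _ => hall k⟩

/-- Membership in `V i` of the composition. [this work] -/
theorem mem_V_iff (i : Fin 3) (S : Finset α) : S ∈ D.toSunflower.V i ↔ ∀ j, j ≠ i → S ∈ D.U j := by
  simp only [toSunflower, mem_filter, mem_univ, true_and]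

/-- Membership in the core `A` of the composition: all three groups fire. [this work] -/
theorem mem_A_iff (S : Finset α) : S ∈ D.toSunflower.A ↔ ∀ j, S ∈ D.U j := by
  unfold Sunflower.A
  rw [mem_inter, D.mem_V_iff, D.mem_V_iff]
  constructor
  · rintro ⟨h0, h1⟩ j
    by_cases hj : j = 0
    · subst hj; exact h1 0 (by decide)
    · exact h0 j hj
  · intro h
    exact ⟨fun j _ => h j, fun j _ => h j⟩

/-! ### The group-wise mixing of three sets -/

/-- `mix S₀ S₁ S₂` = (group-0 part of `S₀`) ∪ (group-1 part of `S₁`) ∪ (group-2 part of `S₂`). [this work] -/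
def mix (S0 S1 S2 : Finset α) : Finset α :=
  (S0.filter fun x => D.grp x = 0) ∪ (S1.filter fun x => D.grp x = 1) ∪ (S2.filter fun x => D.grp x = 2)

/-- Membership in `mix`. [this work] -/
theorem mem_mix (S0 S1 S2 : Finset α) (x : α) :
    x ∈ D.mix S0 S1 S2 ↔ (x ∈ S0 ∧ D.grp x = 0) ∨ (x ∈ S1 ∧ D.grp x = 1) ∨ (x ∈ S2 ∧ D.grp x = 2) := by
  unfold mix
  simp only [mem_union, mem_filter, or_assoc]

/-- The group-`0` part of `mix S₀ S₁ S₂` is that of `S₀`. [this work] -/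
theorem mix_filter0 (S0 S1 S2 : Finset α) : (D.mix S0 S1 S2).filter (fun x => D.grp x = 0) = S0.filter (fun x => D.grp x = 0) := by
  ext x; simp only [mem_filter, D.mem_mix]; constructor
  · rintro ⟨(⟨h, _⟩ | ⟨_, h1⟩ | ⟨_, h2⟩), h0⟩
    · exact ⟨h, h0⟩
    · rw [h1] at h0; exact absurd h0 (by decide)
    · rw [h2] at h0; exact absurd h0 (by decide)
  · rintro ⟨h, h0⟩; exact ⟨Or.inl ⟨h, h0⟩, h0⟩

/-- The group-`1` part of `mix S₀ S₁ S₂` is that of `S₁`. [this work] -/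
theorem mix_filter1 (S0 S1 S2 : Finset α) : (D.mix S0 S1 S2).filter (fun x => D.grp x = 1) = S1.filter (fun x => D.grp x = 1) := by
  ext x; simp only [mem_filter, D.mem_mix]; constructor
  · rintro ⟨(⟨_, h0⟩ | ⟨h, _⟩ | ⟨_, h2⟩), h1⟩
    · rw [h0] at h1; exact absurd h1 (by decide)
    · exact ⟨h, h1⟩
    · rw [h2] at h1; exact absurd h1 (by decide)
  · rintro ⟨h, h1⟩; exact ⟨Or.inr (Or.inl ⟨h, h1⟩), h1⟩

/-- The group-`2` part of `mix S₀ S₁ S₂` is that of `S₂`. [this work] -/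
theorem mix_filter2 (S0 S1 S2 : Finset α) : (D.mix S0 S1 S2).filter (fun x => D.grp x = 2) = S2.filter (fun x => D.grp x = 2) := by
  ext x; simp only [mem_filter, D.mem_mix]; constructor
  · rintro ⟨(⟨_, h0⟩ | ⟨_, h1⟩ | ⟨h, _⟩), h2⟩
    · rw [h0] at h2; exact absurd h2 (by decide)
    · rw [h1] at h2; exact absurd h2 (by decide)
    · exact ⟨h, h2⟩
  · rintro ⟨h, h2⟩; exact ⟨Or.inr (Or.inr ⟨h, h2⟩), h2⟩

/-- Membership of a mixed set in `U i` only depends on the `i`-th argument. [this work] -/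
theorem mix_mem_U0 (S0 S1 S2 : Finset α) : D.mix S0 S1 S2 ∈ D.U 0 ↔ S0 ∈ D.U 0 := by
  rw [D.supp 0, D.mix_filter0, ← D.supp 0]

/-- `mix S₀ S₁ S₂ ∈ U 1 ↔ S₁ ∈ U 1`. [this work] -/
theorem mix_mem_U1 (S0 S1 S2 : Finset α) : D.mix S0 S1 S2 ∈ D.U 1 ↔ S1 ∈ D.U 1 := by
  rw [D.supp 1, D.mix_filter1, ← D.supp 1]

/-- `mix S₀ S₁ S₂ ∈ U 2 ↔ S₂ ∈ U 2`. [this work] -/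
theorem mix_mem_U2 (S0 S1 S2 : Finset α) : D.mix S0 S1 S2 ∈ D.U 2 ↔ S2 ∈ D.U 2 := by
  rw [D.supp 2, D.mix_filter2, ← D.supp 2]

/-- `mix S S S = S` (the groups cover `α`). [this work] -/
theorem mix_self (S : Finset α) : D.mix S S S = S := by
  ext x; rw [D.mem_mix]; constructor
  · rintro (⟨h, _⟩ | ⟨h, _⟩ | ⟨h, _⟩) <;> exact h
  · intro h
    have : D.grp x = 0 ∨ D.grp x = 1 ∨ D.grp x = 2 := by
      generalize D.grp x = g; revert g; decide
    rcases this with h0 | h1 | h2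
    · exact Or.inl ⟨h, h0⟩
    · exact Or.inr (Or.inl ⟨h, h1⟩)
    · exact Or.inr (Or.inr ⟨h, h2⟩)

/-- `mix` only sees the group-`g` part of its `g`-th argument. [this work] -/
theorem mix_congr {S0 S1 S2 T0 T1 T2 : Finset α}
    (h0 : ∀ x, D.grp x = 0 → (x ∈ S0 ↔ x ∈ T0)) (h1 : ∀ x, D.grp x = 1 → (x ∈ S1 ↔ x ∈ T1))
    (h2 : ∀ x, D.grp x = 2 → (x ∈ S2 ↔ x ∈ T2)) : D.mix S0 S1 S2 = D.mix T0 T1 T2 := by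
  ext x; rw [D.mem_mix, D.mem_mix]
  constructor
  · rintro (⟨h, hg⟩ | ⟨h, hg⟩ | ⟨h, hg⟩)
    · exact Or.inl ⟨(h0 x hg).1 h, hg⟩
    · exact Or.inr (Or.inl ⟨(h1 x hg).1 h, hg⟩)
    · exact Or.inr (Or.inr ⟨(h2 x hg).1 h, hg⟩)
  · rintro (⟨h, hg⟩ | ⟨h, hg⟩ | ⟨h, hg⟩)
    · exact Or.inl ⟨(h0 x hg).2 h, hg⟩
    · exact Or.inr (Or.inl ⟨(h1 x hg).2 h, hg⟩)
    · exact Or.inr (Or.inr ⟨(h2 x hg).2 h, hg⟩)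

/-- `mix` commutes with unions. [this work] -/
theorem mix_union (a b c d e f : Finset α) : D.mix a b c ∪ D.mix d e f = D.mix (a ∪ d) (b ∪ e) (c ∪ f) := by
  ext x; simp only [mem_union, D.mem_mix]; tauto

/-- `mix` commutes with complements. [this work] -/
theorem mix_compl (a b c : Finset α) : (D.mix a b c)ᶜ = D.mix aᶜ bᶜ cᶜ := by
  ext x; simp only [mem_compl, D.mem_mix]
  have : D.grp x = 0 ∨ D.grp x = 1 ∨ D.grp x = 2 := by
    generalize D.grp x = g; revert g; decide
  rcases this with h | h | h <;> simp [h]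

/-- Mixed sets built from componentwise disjoint arguments are disjoint. [this work] -/
theorem disjoint_mix {a b c d e f : Finset α} (had : Disjoint a d) (hbe : Disjoint b e) (hcf : Disjoint c f) :
    Disjoint (D.mix a b c) (D.mix d e f) := by
  rw [Finset.disjoint_left]
  intro x hx hx'
  rw [D.mem_mix] at hx hx'
  rcases hx with ⟨h, hg⟩ | ⟨h, hg⟩ | ⟨h, hg⟩ <;> rcases hx' with ⟨h', hg'⟩ | ⟨h', hg'⟩ | ⟨h', hg'⟩ <;>
    first
    | exact Finset.disjoint_left.1 had h h'
    | exact Finset.disjoint_left.1 hbe h h'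
    | exact Finset.disjoint_left.1 hcf h h'
    | (rw [hg] at hg'; exact absurd hg' (by decide))

end StarData

end Summit.CriticalPhenomena.PercolationContinuityZ3.Theorems.SunflowerPartition
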